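import Literature.Computability.AlgebraicComplexity.MS2001Example531Stability
import Mathlib.Algebra.CharP.Two
import Mathlib.Algebra.CharP.Lemmas
import Mathlib.FieldTheory.IsAlgClosed.AlgebraicClosure
import Mathlib.Algebra.Field.ZMod
import Mathlib.LinearAlgebra.Matrix.Charpoly.Coeff
import Literature.Computability.AlgebraicComplexity.BI17QuadraticPolystableProofs
import Literature.Computability.AlgebraicComplexity.BI17DetPerMinimalDegreeProofs
import HarnessLib

/-!
# GCT I §4.1, closing Remark: "the role of the determinant can also be played by the trace" —
# the form `trace(Y^m)`, and the characteristic-2 failure of both announced analogues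

Topic `Computability/AlgebraicComplexity`. Cell `val-lit`, row MS2001-A (K. Mulmuley, M. Sohoni,
*Geometric complexity theory I*, SIAM J. Comput. 31 (2001) 496–526), §4.1, typed from the
AUTHORS' VERSION (AV; text of record `HOME/bip/texts/MS2001-authorversion/`, locators «AV p.N,
all.txt Lnnnn»). The row «§4.1 closing remark» of `HOME/bip/CHECK-t01.md` was SKIPPED (prose).
Theorems and one bodied definition: no named facts, no instances, no `sorry` (the characteristic-2
algebra lemmas are `private` plumbing).

## The source (AV p.16, all.txt L1122–1124)

> "Remark: The role of the determinant in this section can also be played by the trace: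
> specifically, the analogues of Proposition 4.1 and Theorem 4.6 hold for `trace(Y^m)` as well."

Here §4 works over "an algebraically closed field `F` of arbitrary characteristic" (AV p.11,
all.txt L683; Prop. 4.2 and Thms. 4.6/4.7 are stated in arbitrary characteristic), `Y` is an
`m × m` variable matrix, `V` = forms of degree `m` in the entries of `Y`, `G = SL_{m²}(F)`;
**Prop. 4.1**: "If `f(X)`
has a formula of size `l` then `f^φ(Y)` lies in `Δ[det(Y)]`, `m = 2l`" (`f^φ(Y) = y^{m-d} f(X)`,
`X` among the entries of `Y`, `y` another entry; tree: `MS2001_prop_4_1`); **Thm. 4.6**: "`det(Y)`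
is stable" (closed `SL_{m²}`-orbit; tree: `MS2001_thm_4_6_holds`). The announced analogues are
therefore: (4.1-tr) `f` has a formula of size `l` ⇒ `f^φ(Y) ∈ Δ[trace(Y^m)]`, `m = 2l`;
(4.6-tr) `trace(Y^m)` is stable.

## Contents and verdict

* `tracePow F n m = trace(Y^m)` for the `n × n` variable matrix `Y` (bodied definition; the print's
  object is `tracePow F m m`); `isHomogeneous_tracePow` (a form of degree `m`).
* In CHARACTERISTIC `2` both analogues FAIL (ours, kernel-checked):
  - `Matrix.trace_mul_self_eq_sq_of_charTwo`: `tr(A²) = (tr A)²` over any commutative ring of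
    characteristic `2`; hence `tracePow_two_mul`: `trace(Y^{2l}) = trace(Y^l)²` — for the EVEN
    `m = 2l` of Prop. 4.1 the form `trace(Y^m)` is a square.
  - `coeff_eq_zero_of_mem_orbitClosure_sq`: over a field of characteristic `2`, every member of
    the orbit closure `Δ[q²]` of a square has vanishing coefficient at every exponent vector with
    an odd entry (squares are `∑ c_α² Y^{2α}` in characteristic `2`, the orbit of a square consists
    of squares, and the condition is Zariski closed).
  - **(4.1-tr) fails**: `MS2001_rem_4_1_trace_prop_4_1_analogue_false` — for every even `m`
    and distinct entries `x ≠ y` of `Y` (so `m ≥ 2`), `y^{m-1} · x ∉ Δ[trace(Y^m)]`; here `f = x` is a single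
    variable (a formula of size `≤ 1 ≤ l` for every `l`), and for `det` the corresponding padded
    form `y^{m-1} x` DOES lie in `Δ[det_m]` (Prop. 4.1; recorded as
    `X_pow_mul_X_mem_orbitClosure_detPoly`).
  - **(4.6-tr) fails** at `m = 2`: `MS2001_rem_4_1_trace_thm_4_6_analogue_false` —
    `trace(Y²) = (y₁₁ + y₂₂)²` is not polystable (indeed not semistable: the determinant-one
    scalings `diag(t, t⁻¹, t⁻¹, t)` send it to `t² · trace(Y²)`, so `0` is in the closure of its
    `SL₄`-orbit), over every infinite field of characteristic `2` (e.g. `\overline{F_2}`,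
    `MS2001_rem_4_1_trace_thm_4_6_analogue_false_algebraicClosure`).
* §5 EVERY positive characteristic `p`: `tracePow_char_mul` (`trace(Y^{pl}) = trace(Y^l)^p`, from
  `tr(A^p) = (tr A)^p` for matrices over a commutative ring of characteristic `p`, via
  `χ_{A^p} = Frob(χ_A)`), `MS2001_rem_4_1_trace_prop_4_1_analogue_false_charP` (`p ∣ m`,
  `x ≠ y` ⇒ `y^{m-1} x ∉ Δ[trace(Y^m)]`), `MS2001_rem_4_1_trace_thm_4_6_analogue_false_charP`
  (`trace(Y^p) = (∑ y_{ii})^p` is not polystable over any infinite field of characteristic `p`;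
  `…_algebraicClosure_charP` for `\overline{F_p}`). So (4.1-tr) fails whenever `char F ∣ m`
  and (4.6-tr) fails for `m = char F`.
* §6 the case `m = 2` AWAY from characteristic `2`, where both analogues HOLD:
  `MS2001_rem_4_1_trace_prop_4_1_analogue_two` (`2 ≠ 0`, `F` infinite: `y · x ∈ Δ[trace(Y²)]`,
  via `y x = trace(L²)` for `L = (0, x; y/2, 0)`) and
  `MS2001_rem_4_1_trace_thm_4_6_analogue_two_complex` (`trace(Y²)` is polystable over `ℂ`: a
  nondegenerate quadratic form, `GL₄`-translate of `∑ z_i²`, the tree's `isPolystable_sum_X_pow`).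
* Beyond `m = 2`, characteristic `0` is NOT addressed here. The remark is unconditional in
  print; this file records that, as printed for the §4 setting "algebraically closed `F`" of
  arbitrary characteristic, (4.1-tr) fails whenever `char F ∣ m` (in particular for `char F = 2`
  and the even `m = 2l` of Prop. 4.1) and (4.6-tr) fails for `m = char F`.

Honest framing: literature bookkeeping on an unnumbered remark; nothing here bears on any
separation (`VP ≠ VNP` is NOT proved).

## References

* [MulmuleySohoniSIAM2001] K. Mulmuley, M. Sohoni, *Geometric complexity theory I*, SIAM J.
  Comput. 31 (2001) 496–526, §4.1, closing Remark (AV p.16, all.txt L1122–1124); Prop. 4.1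
  (AV p.12, L756), Thm. 4.6 (AV p.15, L935).
-/

noncomputable section

open MvPolynomial

namespace Literature.Computability.AlgebraicComplexity

universe u v

/-! ## §1. The form `trace(Y^m)` -/

section TracePow

variable (F : Type u) [CommSemiring F] (n : ℕ)

/-- **`trace(Y^m)`** for the `n × n` matrix `Y = (y_{ij})` of variables (GCT I §4.1, closing
Remark, AV p.16 L1122–1124: "the analogues of Proposition 4.1 and Theorem 4.6 hold for
`trace(Y^m)`"; the print takes `n = m`). [cite: MulmuleySohoniSIAM2001, §4.1 Remark (AV p.16, all.txt L1122–1124)] -/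
def tracePow (m : ℕ) : MvPolynomial (Fin n × Fin n) F :=
  ((Matrix.mvPolynomialX (Fin n) (Fin n) F) ^ m).trace

/-- The entries of `Y^m` are forms of degree `m`. [folklore] -/
private theorem isHomogeneous_mvPolynomialX_pow : ∀ (m : ℕ) (i j : Fin n),
    (((Matrix.mvPolynomialX (Fin n) (Fin n) F) ^ m) i j).IsHomogeneous m
  | 0, i, j => by
    rw [pow_zero, Matrix.one_apply]
    split_ifs
    · exact isHomogeneous_one _ _
    · exact isHomogeneous_zero _ _ _
  | m + 1, i, j => by
    rw [pow_succ, Matrix.mul_apply]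
    refine IsHomogeneous.sum _ _ _ fun l _ => ?_
    rw [Matrix.mvPolynomialX_apply]
    exact (isHomogeneous_mvPolynomialX_pow m i l).mul (isHomogeneous_X F (l, j))

/-- **`trace(Y^m)` is a form of degree `m`** (so it lives in the `V = Sym^m(Y)` of §4).
[cite: MulmuleySohoniSIAM2001, §4.1 Remark (AV p.16, all.txt L1122–1124)] -/
theorem isHomogeneous_tracePow (m : ℕ) : (tracePow F n m).IsHomogeneous m := by
  rw [tracePow, Matrix.trace]
  exact IsHomogeneous.sum _ _ _ fun i _ =>
    by simpa using isHomogeneous_mvPolynomialX_pow F n m i i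

end TracePow

/-! ## §2. Characteristic 2: `tr(A²) = (tr A)²`, and squares have even exponents -/

section CharTwoAlgebra

/-- **In characteristic `2`, `tr(A²) = (tr A)²`** for every square matrix over a commutative ring
(the off-diagonal products `A_{ij} A_{ji}` pair off, the cross terms `2 A_{ii} A_{jj}` vanish).
[folklore] -/
private theorem Matrix.trace_mul_self_eq_sq_of_charTwo {S : Type u} [CommRing S] [CharP S 2]
    {ι : Type v} [Fintype ι] [DecidableEq ι] (A : Matrix ι ι S) :
    (A * A).trace = A.trace ^ 2 := by
  classical
  simp only [Matrix.trace, Matrix.diag_apply]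
  -- the right-hand side: Frobenius is additive
  rw [sum_pow_char 2 Finset.univ (fun i => A i i)]
  -- the left-hand side: diagonal part plus an involution-cancelling off-diagonal part
  have hsplit : ∀ i : ι, (A * A) i i = A i i ^ 2 + ∑ j ∈ Finset.univ.erase i, A i j * A j i := by
    intro i
    rw [Matrix.mul_apply, ← Finset.add_sum_erase _ _ (Finset.mem_univ i), sq]
  simp only [hsplit, Finset.sum_add_distrib]
  rw [add_eq_left]
  -- the off-diagonal sum over ordered pairs `(i, j)`, `j ≠ i`, vanishes
  rw [← Finset.sum_finset_product' (Finset.univ.filter fun q : ι × ι => q.2 ≠ q.1) Finset.univ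
    (fun i => Finset.univ.erase i) (by simp) (f := fun i j => A i j * A j i)]
  refine Finset.sum_involution (fun q _ => q.swap) ?_ ?_ ?_ ?_
  · intro q _
    rw [Prod.fst_swap, Prod.snd_swap, mul_comm (A q.2 q.1), CharTwo.add_self_eq_zero]
  · intro q hq _
    simp only [Finset.mem_filter, Finset.mem_univ, true_and] at hq
    intro h
    exact hq (by simpa using congrArg Prod.fst h)
  · intro q hq
    simp only [Finset.mem_filter, Finset.mem_univ, true_and] at hq ⊢
    exact fun h => hq h.symm
  · intro q _
    exact Prod.swap_swap q

/-- **In characteristic `2`, squares have even exponents**: the coefficient of `q²` at an exponent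
vector with an odd entry vanishes (in `q² = ∑_{α+α'=β} c_α c_{α'}` the pairs `(α, α')`, `(α', α)`
cancel and `α = α'` is impossible). [folklore] -/
private theorem MvPolynomial.coeff_sq_eq_zero_of_odd {R : Type u} [CommRing R] [CharP R 2]
    {σ : Type v} (q : MvPolynomial σ R) {β : σ →₀ ℕ} {i : σ} (hi : Odd (β i)) :
    coeff β (q ^ 2) = 0 := by
  classical
  rw [sq, coeff_mul]
  refine Finset.sum_involution (fun x _ => x.swap) ?_ ?_ ?_ ?_
  · intro x _
    rw [Prod.fst_swap, Prod.snd_swap, mul_comm (coeff x.2 q), CharTwo.add_self_eq_zero]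
  · intro x hx _ h
    rw [Finset.HasAntidiagonal.mem_antidiagonal] at hx
    have h1 : x.1 = x.2 := by
      have := congrArg Prod.snd h
      simpa using this
    have h2 : β i = 2 * x.1 i := by
      rw [← hx, h1, Finsupp.add_apply, two_mul]
    exact (Nat.not_even_iff_odd.2 hi) ⟨x.1 i, by rw [h2, two_mul]⟩
  · intro x hx
    rw [Finset.HasAntidiagonal.mem_antidiagonal] at hx ⊢
    rw [Prod.fst_swap, Prod.snd_swap, add_comm, hx]
  · intro x _
    exact Prod.swap_swap x

end CharTwoAlgebra

/-! ## §3. In characteristic 2, `trace(Y^{2l})` is a square, and `Δ[q²]` sees only even exponents -/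

section CharTwoForms

variable (F : Type u) [Field F] [CharP F 2]

/-- **`trace(Y^{2l}) = trace(Y^l)²` in characteristic `2`** — for the even `m = 2l` of Prop. 4.1
the form `trace(Y^m)` is a perfect square. [cite: MulmuleySohoniSIAM2001, §4.1 Remark (AV p.16, all.txt L1122–1124)] -/
theorem tracePow_two_mul (n l : ℕ) : tracePow F n (2 * l) = tracePow F n l ^ 2 := by
  rw [tracePow, tracePow, two_mul, pow_add, Matrix.trace_mul_self_eq_sq_of_charTwo]

variable {F}

/-- **The orbit closure of a square sees only even exponents** (characteristic `2`): if
`h ∈ Δ[q²]` then `coeff_β h = 0` for every exponent vector `β` with an odd entry. (Every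
`A · q² = (A · q)²` is a square; the coordinate `coeff_β` vanishes on the orbit, hence on its
Zariski closure.) [folklore] -/
private theorem coeff_eq_zero_of_mem_orbitClosure_sq {σ : Type v} [Fintype σ] [DecidableEq σ]
    {q h : MvPolynomial σ F} (hh : h ∈ orbitClosure (q ^ 2)) {β : σ →₀ ℕ} {i : σ}
    (hi : Odd (β i)) : coeff β h = 0 := by
  rw [mem_orbitClosure_iff] at hh
  have key := hh (X β) fun g hg => by
    obtain ⟨A, rfl⟩ := hg
    simp only [aeval_X, coeffVec_apply, linSubstRep_apply, map_pow]
    exact MvPolynomial.coeff_sq_eq_zero_of_odd _ hi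
  rwa [aeval_X, coeffVec_apply] at key

end CharTwoForms

/-! ## §4. The two analogues announced in the Remark fail in characteristic 2 -/

section Refutations

variable (F : Type u) [Field F]

/-- For comparison — **what Prop. 4.1 gives for the determinant**: the padded variable
`y^{m-1} · x` (`f = x` a single variable, any placement) lies in `Δ[det_m]` over every infinite
field (`X_pow_mul_rename_mem_endOrbit_detPoly` with the `1 × 1` determinantal representation of a
variable, `End · det ⊆ Δ[det]`). [cite: MulmuleySohoniSIAM2001, Prop. 4.1 (AV p.12, all.txt L756)] -/
theorem X_pow_mul_X_mem_orbitClosure_detPoly [Infinite F] {m : ℕ} (hm : 1 ≤ m)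
    (x y : Fin m × Fin m) :
    X y ^ (m - 1) * X x ∈ orbitClosure (detPoly (Fin m) F) := by
  have hrepr : HasDetRepr (X () : MvPolynomial Unit F) 1 := by
    refine ⟨fun _ _ => X (), fun _ _ => (totalDegree_X _).le, ?_⟩
    rw [Matrix.det_unique]
  have h := X_pow_mul_rename_mem_endOrbit_detPoly (isHomogeneous_X F ()) hm
    (HasDetRepr.mono_holds hrepr hm) (fun _ => x) y
  rw [rename_X] at h
  exact endOrbit_subset_orbitClosure_holds _ h

variable [CharP F 2]

/-- **The analogue of Prop. 4.1 for `trace(Y^m)` FAILS in characteristic `2`** (GCT I §4.1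
closing Remark, AV p.16 L1122–1124, as printed for "an algebraically closed field `F`" of
arbitrary characteristic): for every EVEN `m` (Prop. 4.1 has `m = 2l`; two distinct entries exist
iff `m ≥ 2`) and any two distinct entries `x ≠ y` of the `m × m` variable matrix `Y`, the padded single variable `y^{m-1} · x`
(`f = x`, a formula of size `≤ 1 ≤ l`; `f^φ(Y) = y^{m-d} f`, `d = 1`) does NOT lie in
`Δ[trace(Y^m)]` — although it lies in `Δ[det_m]` (`X_pow_mul_X_mem_orbitClosure_detPoly`).
Reason: `trace(Y^m) = trace(Y^{m/2})²` is a square (`tracePow_two_mul`), and the orbit closure of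
a square in characteristic `2` only contains forms with even exponents
(`coeff_eq_zero_of_mem_orbitClosure_sq`), while `x` occurs with exponent `1`. Ours; the
characteristic-`0` case of the Remark is not addressed.
[cite: MulmuleySohoniSIAM2001, §4.1 Remark (AV p.16, all.txt L1122–1124)] -/
theorem MS2001_rem_4_1_trace_prop_4_1_analogue_false {m : ℕ} (hm : Even m)
    {x y : Fin m × Fin m} (hxy : x ≠ y) :
    X y ^ (m - 1) * X x ∉ orbitClosure (tracePow F m m) := by
  classical
  obtain ⟨l, hl⟩ := hm
  have hexp : tracePow F m m = tracePow F m l ^ 2 := by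
    rw [show tracePow F m m = tracePow F m (2 * l) by rw [two_mul, ← hl], tracePow_two_mul]
  rw [hexp]
  intro hmem
  set β : Fin m × Fin m →₀ ℕ := Finsupp.single y (m - 1) + Finsupp.single x 1 with hβ
  have hodd : Odd (β x) := by
    rw [hβ, Finsupp.add_apply, Finsupp.single_eq_of_ne hxy, Finsupp.single_eq_same, zero_add]
    exact odd_one
  have hzero := coeff_eq_zero_of_mem_orbitClosure_sq hmem hodd
  have hone : coeff β (X y ^ (m - 1) * X x : MvPolynomial (Fin m × Fin m) F) = 1 := by
    rw [X_pow_eq_monomial, X, monomial_mul, mul_one, coeff_monomial, if_pos hβ.symm]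
  rw [hone] at hzero
  exact one_ne_zero hzero

/-- The `m = 2` instance of the Remark's objects: `trace(Y²) = (y₀₀ + y₁₁)²` in characteristic `2`.
[cite: MulmuleySohoniSIAM2001, §4.1 Remark (AV p.16, all.txt L1122–1124)] -/
theorem tracePow_two_two_eq :
    tracePow F 2 2 = (X ((0 : Fin 2), (0 : Fin 2)) + X ((1 : Fin 2), (1 : Fin 2))) ^ 2 := by
  have h := tracePow_two_mul F 2 1
  rw [mul_one] at h
  rw [h, tracePow, pow_one, Matrix.trace_fin_two, Matrix.mvPolynomialX_apply,
    Matrix.mvPolynomialX_apply]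

/-- The determinant-one diagonal scaling `diag(t, t⁻¹, t⁻¹, t)` of the four entries of the `2 × 2`
matrix `Y` multiplies `trace(Y²) = (y₀₀ + y₁₁)²` by `t²` (characteristic `2`). [folklore] -/
private theorem linSubst_diag_tracePow_two (t : F) :
    linSubst (Fin 2 × Fin 2) F
        (Matrix.diagonal fun q : Fin 2 × Fin 2 => if q.1 = q.2 then t else t⁻¹)
        (tracePow F 2 2) = t ^ 2 • tracePow F 2 2 := by
  rw [tracePow_two_two_eq, map_pow, map_add, Grenet.linSubst_diagonal_X,
    Grenet.linSubst_diagonal_X]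
  simp only [if_true, smul_eq_C_mul, map_pow]
  ring

/-- **The analogue of Thm. 4.6 for `trace(Y^m)` FAILS in characteristic `2`** (GCT I §4.1 closing
Remark, AV p.16 L1122–1124; Thm. 4.6: "`det(Y) ∈ P(V)` is stable", i.e. the `SL_{m²}`-orbit is
closed, tree `MS2001_thm_4_6_holds`): for `m = 2` over any infinite field of characteristic `2`,
`trace(Y²) = (y₀₀ + y₁₁)²` is NOT polystable — it is not even semistable: the determinant-one
scalings `diag(t, t⁻¹, t⁻¹, t)` give `t² · trace(Y²) ∈ SL₄ · trace(Y²)` for all `t ≠ 0`, so `0` lies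
in the Zariski closure of the orbit (`MS2001Example531.zero_mem_zariskiClosure_slOrbit_of_smul_mem`).
Ours; the characteristic-`0` case of the Remark is not addressed.
[cite: MulmuleySohoniSIAM2001, §4.1 Remark (AV p.16, all.txt L1122–1124)] -/
theorem MS2001_rem_4_1_trace_thm_4_6_analogue_false [Infinite F] : ¬ IsPolystable (tracePow F 2 2) := by
  have hzero : coeffVec (0 : MvPolynomial (Fin 2 × Fin 2) F) ∈
      zariskiClosure (coeffVec '' slOrbit (Fin 2 × Fin 2) F (tracePow F 2 2)) := by
    refine MS2001Example531.zero_mem_zariskiClosure_slOrbit_of_smul_mem (e := 2) two_pos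
      fun t ht => ?_
    have hdet : (Matrix.diagonal fun q : Fin 2 × Fin 2 => if q.1 = q.2 then t else t⁻¹).det = 1 := by
      rw [Matrix.det_diagonal, Fintype.prod_prod_type]
      simp [Fin.prod_univ_two, mul_inv_cancel₀ ht, inv_mul_cancel₀ ht]
    exact ⟨⟨_, hdet⟩, (linSubst_diag_tracePow_two F t).symm⟩
  have hne : tracePow F 2 2 ≠ 0 := by
    intro h0
    have h := congrArg (eval fun q : Fin 2 × Fin 2 =>
      if q = ((0 : Fin 2), (0 : Fin 2)) then (1 : F) else 0) h0
    rw [tracePow_two_two_eq, map_pow, map_add, eval_X, eval_X, map_zero] at h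
    simp at h
  exact fun hst => (hst.isSLSemistable hne) hzero

/-- **The Thm. 4.6 analogue fails over the algebraically closed field `\overline{F_2}`** (the
print's "algebraically closed field `F`", arbitrary characteristic).
[cite: MulmuleySohoniSIAM2001, §4.1 Remark (AV p.16, all.txt L1122–1124)] -/
theorem MS2001_rem_4_1_trace_thm_4_6_analogue_false_algebraicClosure :
    ¬ IsPolystable (tracePow (AlgebraicClosure (ZMod 2)) 2 2) :=
  MS2001_rem_4_1_trace_thm_4_6_analogue_false (AlgebraicClosure (ZMod 2))

end Refutations


/-! ## §5. Every positive characteristic: `tr(A^p) = (tr A)^p`, and both analogues fail for `p ∣ m` -/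

section CharP

open Polynomial in
/-- **The characteristic polynomial of the Frobenius power**: over a commutative ring of prime
characteristic `p`, `χ_{A^p} = Frob(χ_A)` (coefficientwise `p`-th powers), because
`(X - A)^p = X^p - A^p` in `M_n(R)[X]` and `χ_A(X)^p = (Frob χ_A)(X^p)`. (Mathlib has the
finite-field case `FiniteField.Matrix.charpoly_pow_card`; same proof.) [folklore] -/
private theorem Matrix.charpoly_pow_char {R : Type u} [CommRing R] (p : ℕ) [Fact p.Prime]
    [CharP R p] {ι : Type v} [Fintype ι] [DecidableEq ι] (A : Matrix ι ι R) :
    (A ^ p).charpoly = A.charpoly.map (frobenius R p) := by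
  cases (isEmpty_or_nonempty ι).symm
  · apply Polynomial.expand_injective (Fact.out : p.Prime).pos
    rw [← Polynomial.map_expand, Polynomial.map_frobenius_expand]
    unfold Matrix.charpoly
    rw [AlgHom.map_det, ← Matrix.coe_detMonoidHom,
      ← (Matrix.detMonoidHom : Matrix ι ι (Polynomial R) →* Polynomial R).map_pow]
    apply congr_arg Matrix.det
    refine matPolyEquiv.injective ?_
    rw [map_pow, Matrix.matPolyEquiv_charmatrix, sub_pow_char_of_commute, ← Polynomial.C_pow]
    · exact matPolyEquiv_eq_X_pow_sub_C p A
    · exact (Polynomial.C A).commute_X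
  · rw [Matrix.charpoly, Matrix.charpoly, Matrix.det_isEmpty, Matrix.det_isEmpty,
      Polynomial.map_one]

/-- **`tr(A^p) = (tr A)^p` in characteristic `p`** for every square matrix over a commutative
ring of prime characteristic `p` (from `Matrix.charpoly_pow_char` and `tr = -`coefficient of
`X^{n-1}`). [folklore] -/
private theorem Matrix.trace_pow_char {R : Type u} [CommRing R] (p : ℕ) [Fact p.Prime]
    [CharP R p] {ι : Type v} [Fintype ι] [DecidableEq ι] (A : Matrix ι ι R) :
    (A ^ p).trace = A.trace ^ p := by
  cases isEmpty_or_nonempty ι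
  · simp [Matrix.trace, zero_pow (Fact.out : p.Prime).ne_zero]
  rw [Matrix.trace_eq_neg_charpoly_coeff, Matrix.trace_eq_neg_charpoly_coeff,
    Matrix.charpoly_pow_char p, Polynomial.coeff_map, frobenius_def, neg_pow,
    neg_one_pow_char, neg_one_mul]

/-- **In characteristic `p`, `p`-th powers have exponents divisible by `p`**: the coefficient
of `q^p` at an exponent vector with an entry not divisible by `p` vanishes
(`q^p = ∑ c_α^p Y^{pα}`). [folklore] -/
private theorem MvPolynomial.coeff_pow_char_eq_zero {R : Type u} [CommRing R] (p : ℕ)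
    [Fact p.Prime] [CharP R p] {σ : Type v} (q : MvPolynomial σ R) {β : σ →₀ ℕ} {i : σ}
    (hi : ¬ p ∣ β i) : coeff β (q ^ p) = 0 := by
  classical
  conv_lhs => rw [q.as_sum, sum_pow_char, coeff_sum]
  refine Finset.sum_eq_zero fun α _ => ?_
  rw [monomial_pow, coeff_monomial, if_neg]
  intro h
  apply hi
  rw [← h, Finsupp.smul_apply, smul_eq_mul]
  exact Dvd.intro _ rfl

variable (F : Type u) [Field F] (p : ℕ) [Fact p.Prime] [CharP F p]

/-- **`trace(Y^{pl}) = trace(Y^l)^p` in characteristic `p`** — for `p ∣ m` the form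
`trace(Y^m)` is a `p`-th power. [cite: MulmuleySohoniSIAM2001, §4.1 Remark (AV p.16, all.txt L1122–1124)] -/
theorem tracePow_char_mul (n l : ℕ) : tracePow F n (p * l) = tracePow F n l ^ p := by
  rw [tracePow, tracePow, mul_comm, pow_mul, Matrix.trace_pow_char p]

variable {F}

/-- The orbit closure of a `p`-th power sees only exponents divisible by `p` (characteristic
`p`): if `h ∈ Δ[q^p]` then `coeff_β h = 0` whenever some `β_i` is not divisible by `p`.
[folklore] -/
private theorem coeff_eq_zero_of_mem_orbitClosure_pow_char {σ : Type v} [Fintype σ]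
    [DecidableEq σ] {q h : MvPolynomial σ F} (hh : h ∈ orbitClosure (q ^ p)) {β : σ →₀ ℕ}
    {i : σ} (hi : ¬ p ∣ β i) : coeff β h = 0 := by
  rw [mem_orbitClosure_iff] at hh
  have key := hh (X β) fun g hg => by
    obtain ⟨A, rfl⟩ := hg
    simp only [aeval_X, coeffVec_apply, linSubstRep_apply, map_pow]
    exact MvPolynomial.coeff_pow_char_eq_zero p _ hi
  rwa [aeval_X, coeffVec_apply] at key

variable (F)

/-- **The analogue of Prop. 4.1 for `trace(Y^m)` FAILS in every positive characteristic
`p ∣ m`** (GCT I §4.1 closing Remark, AV p.16 L1122–1124, as printed for "an algebraically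
closed field `F` of arbitrary characteristic"): over a field of characteristic `p`, if `p ∣ m`
then for any two distinct entries `x ≠ y` of the `m × m` variable matrix the padded variable
`y^{m-1} · x` does NOT lie in `Δ[trace(Y^m)]` (although it lies in `Δ[det_m]`,
`X_pow_mul_X_mem_orbitClosure_detPoly`): `trace(Y^m) = trace(Y^{m/p})^p` is a `p`-th power, whose
orbit closure only contains forms with all exponents divisible by `p`. The characteristic-2 case
is `MS2001_rem_4_1_trace_prop_4_1_analogue_false`. Ours; characteristic `0` not addressed.
[cite: MulmuleySohoniSIAM2001, §4.1 Remark (AV p.16, all.txt L1122–1124)] -/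
theorem MS2001_rem_4_1_trace_prop_4_1_analogue_false_charP {m : ℕ} (hm : p ∣ m)
    {x y : Fin m × Fin m} (hxy : x ≠ y) :
    X y ^ (m - 1) * X x ∉ orbitClosure (tracePow F m m) := by
  classical
  obtain ⟨l, hl⟩ := hm
  have hexp : tracePow F m m = tracePow F m l ^ p := by
    rw [show tracePow F m m = tracePow F m (p * l) by rw [← hl], tracePow_char_mul]
  rw [hexp]
  intro hmem
  set β : Fin m × Fin m →₀ ℕ := Finsupp.single y (m - 1) + Finsupp.single x 1 with hβ
  have hβx : β x = 1 := by
    rw [hβ, Finsupp.add_apply, Finsupp.single_eq_of_ne hxy, Finsupp.single_eq_same, zero_add]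
  have hndvd : ¬ p ∣ β x := by
    rw [hβx, Nat.dvd_one]
    exact (Fact.out : p.Prime).ne_one
  have hzero := coeff_eq_zero_of_mem_orbitClosure_pow_char p hmem hndvd
  have hone : coeff β (X y ^ (m - 1) * X x : MvPolynomial (Fin m × Fin m) F) = 1 := by
    rw [X_pow_eq_monomial, X, monomial_mul, mul_one, coeff_monomial, if_pos hβ.symm]
  rw [hone] at hzero
  exact one_ne_zero hzero

/-- `trace(Y^p) = (∑_i y_{ii})^p` in characteristic `p` (the `m = p` instance of the Remark's
object). [cite: MulmuleySohoniSIAM2001, §4.1 Remark (AV p.16, all.txt L1122–1124)] -/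
theorem tracePow_char_self_eq :
    tracePow F p p = (∑ i : Fin p, X (i, i)) ^ p := by
  have h := tracePow_char_mul F p p 1
  rw [mul_one] at h
  rw [h, tracePow, pow_one, Matrix.trace]
  simp only [Matrix.diag_apply, Matrix.mvPolynomialX_apply]

/-- The determinant-one diagonal scaling `y_{ii} ↦ u^{p-1} y_{ii}`, `y_{ij} ↦ u⁻¹ y_{ij}` (`i ≠ j`)
of the `p × p` variable matrix multiplies `trace(Y^p) = (∑ y_{ii})^p` by `u^{(p-1)p}`
(characteristic `p`). [folklore] -/
private theorem linSubst_diag_tracePow_char (u : F) :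
    linSubst (Fin p × Fin p) F
        (Matrix.diagonal fun q : Fin p × Fin p => if q.1 = q.2 then u ^ (p - 1) else u⁻¹)
        (tracePow F p p) = u ^ ((p - 1) * p) • tracePow F p p := by
  rw [tracePow_char_self_eq, map_pow, map_sum]
  have h : ∀ i : Fin p, linSubst (Fin p × Fin p) F
      (Matrix.diagonal fun q : Fin p × Fin p => if q.1 = q.2 then u ^ (p - 1) else u⁻¹)
      (X (i, i)) = u ^ (p - 1) • X (i, i) := fun i => by
    rw [Grenet.linSubst_diagonal_X, if_pos rfl]
  simp only [h, ← Finset.smul_sum, smul_pow, ← pow_mul]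

omit [Fact p.Prime] [CharP F p] in
/-- The scaling has determinant `1`. [folklore] -/
private theorem det_diag_scaling {u : F} (hu : u ≠ 0) :
    (Matrix.diagonal fun q : Fin p × Fin p => if q.1 = q.2 then u ^ (p - 1) else u⁻¹).det = 1 := by
  have hdiag : (Finset.univ.filter fun q : Fin p × Fin p => q.1 = q.2) =
      (Finset.univ : Finset (Fin p)).diag := by
    ext q
    simp [Finset.mem_diag]
  have hoff : (Finset.univ.filter fun q : Fin p × Fin p => ¬ q.1 = q.2) =
      (Finset.univ : Finset (Fin p)).offDiag := by
    ext q
    simp [Finset.mem_offDiag]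
  rw [Matrix.det_diagonal, Finset.prod_ite, Finset.prod_const, Finset.prod_const, hdiag, hoff,
    Finset.diag_card, Finset.offDiag_card, Finset.card_univ, Fintype.card_fin, ← pow_mul,
    inv_pow, show p * p - p = (p - 1) * p by rw [Nat.sub_one_mul],
    mul_inv_cancel₀ (pow_ne_zero _ hu)]

/-- **The analogue of Thm. 4.6 for `trace(Y^m)` FAILS in every positive characteristic** (GCT I
§4.1 closing Remark, AV p.16 L1122–1124): for `m = p = char F` (any prime) over an infinite
field, `trace(Y^p) = (∑_i y_{ii})^p` is NOT polystable — not even semistable: the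
determinant-one scalings `diag(u^{p-1} on the diagonal variables, u⁻¹ elsewhere)` give
`u^{(p-1)p} · trace(Y^p) ∈ SL_{p²} · trace(Y^p)` for all `u ≠ 0`, so `0` lies in the Zariski
closure of the orbit. The case `p = 2` is `MS2001_rem_4_1_trace_thm_4_6_analogue_false`. Ours;
characteristic `0` not addressed.
[cite: MulmuleySohoniSIAM2001, §4.1 Remark (AV p.16, all.txt L1122–1124)] -/
theorem MS2001_rem_4_1_trace_thm_4_6_analogue_false_charP [Infinite F] :
    ¬ IsPolystable (tracePow F p p) := by
  have hp : p.Prime := Fact.out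
  have he : 0 < (p - 1) * p := Nat.mul_pos (by have := hp.two_le; omega) hp.pos
  have hzero : coeffVec (0 : MvPolynomial (Fin p × Fin p) F) ∈
      zariskiClosure (coeffVec '' slOrbit (Fin p × Fin p) F (tracePow F p p)) := by
    refine MS2001Example531.zero_mem_zariskiClosure_slOrbit_of_smul_mem he fun u hu => ?_
    exact ⟨⟨_, det_diag_scaling F p hu⟩, (linSubst_diag_tracePow_char F p u).symm⟩
  have hne : tracePow F p p ≠ 0 := by
    intro h0
    have h := congrArg (eval fun q : Fin p × Fin p =>
      if q = (⟨0, hp.pos⟩, ⟨0, hp.pos⟩) then (1 : F) else 0) h0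
    rw [tracePow_char_self_eq, map_pow, map_sum, map_zero] at h
    simp only [eval_X] at h
    rw [Finset.sum_eq_single (⟨0, hp.pos⟩ : Fin p) (fun b _ hb => if_neg (by
        intro hq; exact hb (Prod.ext_iff.1 hq).1)) (fun h' => absurd (Finset.mem_univ _) h'),
      if_pos rfl, one_pow] at h
    exact one_ne_zero h
  exact fun hst => (hst.isSLSemistable hne) hzero

/-- **The Thm. 4.6 analogue fails over `\overline{F_p}` for every prime `p`.**
[cite: MulmuleySohoniSIAM2001, §4.1 Remark (AV p.16, all.txt L1122–1124)] -/
theorem MS2001_rem_4_1_trace_thm_4_6_analogue_false_algebraicClosure_charP :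
    ¬ IsPolystable (tracePow (AlgebraicClosure (ZMod p)) p p) :=
  MS2001_rem_4_1_trace_thm_4_6_analogue_false_charP (AlgebraicClosure (ZMod p)) p

end CharP


/-! ## §6. The case `m = 2` away from characteristic `2`: both analogues HOLD -/

section TwoByTwo

variable (F : Type u) [Field F]

/-- `trace(Y²) = ∑_{i,j} y_{ij} y_{ji}`. [cite: MulmuleySohoniSIAM2001, §4.1 Remark (AV p.16, all.txt L1122–1124)] -/
theorem tracePow_two_eq_sum (n : ℕ) :
    tracePow F n 2 = ∑ i : Fin n, ∑ j : Fin n, X (i, j) * X (j, i) := by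
  rw [tracePow, sq, Matrix.trace]
  refine Finset.sum_congr rfl fun i _ => ?_
  rw [Matrix.diag_apply, Matrix.mul_apply]
  refine Finset.sum_congr rfl fun j _ => ?_
  rw [Matrix.mvPolynomialX_apply, Matrix.mvPolynomialX_apply]

/-- **The Prop. 4.1 analogue HOLDS for `trace(Y²)` when `2 ≠ 0`** (the `m = 2`, `f = x` instance
of the Remark, complementing `MS2001_rem_4_1_trace_prop_4_1_analogue_false`): over an infinite
field with `2 ≠ 0`, for any two entries `x, y` of the `2 × 2` variable matrix,
`y · x ∈ Δ[trace(Y²)]` — indeed `y x = trace(L²)` for the singular substitution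
`L = (0, x; y/2, 0)`, so `y · x ∈ End · trace(Y²)`.
[cite: MulmuleySohoniSIAM2001, §4.1 Remark (AV p.16, all.txt L1122–1124)] -/
theorem MS2001_rem_4_1_trace_prop_4_1_analogue_two [Infinite F] (h2 : (2 : F) ≠ 0)
    (x y : Fin 2 × Fin 2) :
    X y ^ (2 - 1) * X x ∈ orbitClosure (tracePow F 2 2) := by
  classical
  haveI : NeZero (2 : F) := ⟨h2⟩
  -- the substitution `y_{01} ↦ x`, `y_{10} ↦ y/2`, `y_{00}, y_{11} ↦ 0`
  let A : Matrix (Fin 2 × Fin 2) (Fin 2 × Fin 2) F := Matrix.of fun p q =>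
    if q = ((0 : Fin 2), (1 : Fin 2)) then (if p = x then 1 else 0)
    else if q = ((1 : Fin 2), (0 : Fin 2)) then (if p = y then 2⁻¹ else 0) else 0
  have hA : ∀ q : Fin 2 × Fin 2, linSubst (Fin 2 × Fin 2) F A (X q) =
      if q = ((0 : Fin 2), (1 : Fin 2)) then X x
      else if q = ((1 : Fin 2), (0 : Fin 2)) then (2 : F)⁻¹ • X y else 0 := by
    intro q
    rw [linSubst_X]
    simp only [A, Matrix.of_apply]
    split_ifs with h1 h2
    · simp [ite_smul, Finset.sum_ite_eq']
    · simp [ite_smul, Finset.sum_ite_eq']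
    · simp
  have h00 : linSubst (Fin 2 × Fin 2) F A (X ((0 : Fin 2), (0 : Fin 2))) = 0 := by
    rw [hA, if_neg (by decide), if_neg (by decide)]
  have h11 : linSubst (Fin 2 × Fin 2) F A (X ((1 : Fin 2), (1 : Fin 2))) = 0 := by
    rw [hA, if_neg (by decide), if_neg (by decide)]
  have h01 : linSubst (Fin 2 × Fin 2) F A (X ((0 : Fin 2), (1 : Fin 2))) = X x := by
    rw [hA, if_pos rfl]
  have h10 : linSubst (Fin 2 × Fin 2) F A (X ((1 : Fin 2), (0 : Fin 2))) = (2 : F)⁻¹ • X y := by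
    rw [hA, if_neg (by decide), if_pos rfl]
  refine endOrbit_subset_orbitClosure_holds _ ⟨A, ?_⟩
  show linSubst (Fin 2 × Fin 2) F A (tracePow F 2 2) = _
  rw [tracePow_two_eq_sum]
  simp only [Fin.sum_univ_two, Fin.isValue, map_add, map_mul, h00, h01, h10, h11,
    mul_zero, zero_add, add_zero]
  rw [mul_smul_comm, smul_mul_assoc, mul_comm (X x) (X y), ← add_smul, ← one_div, add_halves,
    one_smul, pow_one]

/-- **The Thm. 4.6 analogue HOLDS for `trace(Y²)` over `ℂ`** (the `m = 2` instance of the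
Remark in characteristic `0`, complementing `MS2001_rem_4_1_trace_thm_4_6_analogue_false`):
`trace(Y²) = y₀₀² + y₁₁² + 2 y₀₁ y₁₀` is a nondegenerate quadratic form in the four entries, hence
a `GL₄`-translate of `∑ z_i²`, whose `SL`-orbit is closed (the tree's `isPolystable_sum_X_pow`;
polystability is a property of `GL`-orbits, `IsPolystable.linSubst_of_det_ne_zero`, and of the
naming of the variables, `IsPolystable.rename_equiv`).
[cite: MulmuleySohoniSIAM2001, §4.1 Remark (AV p.16, all.txt L1122–1124)] -/
theorem MS2001_rem_4_1_trace_thm_4_6_analogue_two_complex : IsPolystable (tracePow ℂ 2 2) := by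
  classical
  -- `∑_q y_q²` on the four entries is polystable
  have hS : IsPolystable (∑ q : Fin 2 × Fin 2, (X q : MvPolynomial (Fin 2 × Fin 2) ℂ) ^ 2) := by
    have e : Fin 4 ≃ Fin 2 × Fin 2 := (finProdFinEquiv (m := 2) (n := 2)).symm
    have h := IsPolystable.rename_equiv e (isPolystable_sum_X_pow 4 one_lt_two)
    rw [map_sum] at h
    simp only [map_pow, rename_X] at h
    rwa [Equiv.sum_comp e (fun q : Fin 2 × Fin 2 =>
      (X q : MvPolynomial (Fin 2 × Fin 2) ℂ) ^ 2)] at h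
  -- the substitution `y₀₀ ↦ y₀₀`, `y₁₁ ↦ y₁₁`, `y₀₁ ↦ y₀₁ + y₁₀/2`, `y₁₀ ↦ i y₀₁ - (i/2) y₁₀`
  let a : Fin 2 × Fin 2 := ((0 : Fin 2), (0 : Fin 2))
  let b : Fin 2 × Fin 2 := ((0 : Fin 2), (1 : Fin 2))
  let c : Fin 2 × Fin 2 := ((1 : Fin 2), (0 : Fin 2))
  let d : Fin 2 × Fin 2 := ((1 : Fin 2), (1 : Fin 2))
  let A : Matrix (Fin 2 × Fin 2) (Fin 2 × Fin 2) ℂ := Matrix.of fun p q =>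
    if q = a then (if p = a then 1 else 0)
    else if q = d then (if p = d then 1 else 0)
    else if q = b then (if p = b then 1 else if p = c then 2⁻¹ else 0)
    else (if p = b then Complex.I else if p = c then -(Complex.I / 2) else 0)
  let B : Matrix (Fin 2 × Fin 2) (Fin 2 × Fin 2) ℂ := Matrix.of fun p q =>
    if q = a then (if p = a then 1 else 0)
    else if q = d then (if p = d then 1 else 0)
    else if q = b then (if p = b then 2⁻¹ else if p = c then -(Complex.I / 2) else 0)
    else (if p = b then 1 else if p = c then Complex.I else 0)
  have hab : a ≠ b := by decide
  have hac : a ≠ c := by decide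
  have had : a ≠ d := by decide
  have hbc : b ≠ c := by decide
  have hbd : b ≠ d := by decide
  have hcd : c ≠ d := by decide
  have huniv : ∀ f : Fin 2 × Fin 2 → MvPolynomial (Fin 2 × Fin 2) ℂ,
      ∑ q, f q = f a + f b + f c + f d := fun f => by
    rw [Fintype.sum_prod_type, Fin.sum_univ_two, Fin.sum_univ_two, Fin.sum_univ_two]
    simp only [a, b, c, d, add_assoc]
  have huniv' : ∀ f : Fin 2 × Fin 2 → ℂ, ∑ q, f q = f a + f b + f c + f d := fun f => by
    rw [Fintype.sum_prod_type, Fin.sum_univ_two, Fin.sum_univ_two, Fin.sum_univ_two]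
    simp only [a, b, c, d, add_assoc]
  -- `A` is invertible: `A * B = 1`
  have hAB : A * B = 1 := by
    ext p q
    rw [Matrix.mul_apply, huniv', Matrix.one_apply]
    simp only [A, B, Matrix.of_apply, if_true, if_false, hab, hac, had, hbc, hbd, hcd, hab.symm,
      hac.symm, had.symm, hbc.symm, hbd.symm, hcd.symm]
    have hp : p = a ∨ p = b ∨ p = c ∨ p = d := by
      rcases p with ⟨p1, p2⟩
      fin_cases p1 <;> fin_cases p2 <;> simp [a, b, c, d]
    have hq : q = a ∨ q = b ∨ q = c ∨ q = d := by
      rcases q with ⟨q1, q2⟩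
      fin_cases q1 <;> fin_cases q2 <;> simp [a, b, c, d]
    rcases hp with rfl | rfl | rfl | rfl <;> rcases hq with rfl | rfl | rfl | rfl <;>
      simp [hab, hac, had, hbc, hbd, hcd, hab.symm, hac.symm, had.symm, hbc.symm, hbd.symm,
        hcd.symm] <;> ring_nf <;> simp [Complex.ext_iff] <;> norm_num
  have hdet : A.det ≠ 0 := by
    intro h0
    have h := congrArg Matrix.det hAB
    rw [Matrix.det_mul, h0, zero_mul, Matrix.det_one] at h
    exact zero_ne_one h
  -- `A · ∑ y_q² = trace(Y²)`
  have hX : ∀ q, linSubst (Fin 2 × Fin 2) ℂ A (X q) =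
      A a q • X a + A b q • X b + A c q • X c + A d q • X d := fun q => by
    rw [linSubst_X, huniv]
  have hsub : linSubst (Fin 2 × Fin 2) ℂ A (∑ q : Fin 2 × Fin 2, X q ^ 2) = tracePow ℂ 2 2 := by
    rw [map_sum, huniv, map_pow, map_pow, map_pow, map_pow, hX, hX, hX, hX, tracePow_two_eq_sum,
      Fin.sum_univ_two, Fin.sum_univ_two, Fin.sum_univ_two]
    simp only [A, Matrix.of_apply, if_true, if_false, hab, hac, had, hbc, hbd, hcd, hab.symm,
      hac.symm, had.symm, hbc.symm, hbd.symm, hcd.symm, one_smul, zero_smul, add_zero, zero_add,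
      smul_eq_C_mul]
    simp only [a, b, c, d, Fin.isValue]
    have hI : (C Complex.I : MvPolynomial (Fin 2 × Fin 2) ℂ) ^ 2 = -1 := by
      rw [← map_pow, Complex.I_sq, map_neg, map_one]
    have h2 : (C (2⁻¹ : ℂ) : MvPolynomial (Fin 2 × Fin 2) ℂ) * 2 = 1 := by
      rw [← map_ofNat C, ← map_mul, inv_mul_cancel₀ two_ne_zero, map_one]
    have hI2 : (C (-(Complex.I / 2)) : MvPolynomial (Fin 2 × Fin 2) ℂ) =
        -(C Complex.I * C (2⁻¹ : ℂ)) := by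
      rw [← map_mul, ← map_neg, div_eq_mul_inv]
    rw [hI2]
    linear_combination (X ((0 : Fin 2), (1 : Fin 2)) ^ 2 +
      (C (2⁻¹ : ℂ)) ^ 2 * X ((1 : Fin 2), (0 : Fin 2)) ^ 2 -
      2 * C (2⁻¹ : ℂ) * X ((0 : Fin 2), (1 : Fin 2)) * X ((1 : Fin 2), (0 : Fin 2))) * hI +
      (2 * X ((0 : Fin 2), (1 : Fin 2)) * X ((1 : Fin 2), (0 : Fin 2))) * h2
  rw [← hsub]
  exact hS.linSubst_of_det_ne_zero hdet

end TwoByTwo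

end Literature.Computability.AlgebraicComplexity
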